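import Summits.BirchSwinnertonDyer.Rank1Residual.X4.KolyvaginIndexRecordsKitOddPrime
import HarnessLib

/-!
# BSD rank-≤1 residual cell, lane class X11b (`p ∥ N`: MULTIPLICATIVE at a prime `p ≥ 5`, `ρ̄_{E,p}` irreducible),
rank ONE: `BSD(E,p)` PER PAIR from
# PUBLISHED theorems + Kolyvagin's HEEGNER-INDEX certificate (two engines), `ρ̄_{E,p}` onto IN THE KERNEL — records 17

HONEST FRAMING (cell `b2b-bsdres-*`, verbatim): prove what is provable now; shrink each hard class to its core with
data; no claim beyond stated classes; COMBINATION classes deleted from PUBLISHED theorems only, CONSTRUCTION-shaped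
remainder typed; this is not "finishing BSD". X11b stays CONSTRUCTION-SHAPED; everything here is PER PAIR; no lane
verdict is changed; no named fact is introduced (debt 0); nothing is booked by this unit (the rung-K2 owner
bsd-stepL, the x11b
lineage that holds row B9's E1/K2 claim, census-lead, the Kurihara lane and referee A decide what a record is
worth); Cremona's numbers
(`r_an = 1`, `#Ш_an`, models, generators, `∏ c_ℓ`, torsion, optimality / Manin codes, the galrep datum) are INPUTS.

Unit `b2b-bsdres-x11c`, GEN 32 (prover-b2b-bsdres-x11c-g32-0) — the «X11 beyond 3» half of the unit's D-0075 purpose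
(«GRH-free
Kolyvagin–Heegner-index certificates X4 r1 p ≥ 7, X11 beyond 3»): the cell's certificate engines turned on lane
class X11b as GEN 27–31 turned
them on X7 (`Supersingular/KolyvaginIndexRecordsX7RankOne01–432`). POPULATION
(`HOME/b2b-bsdres-x11c/gen32/pop/build_harvest_x11b.py` = gen 27's
class-agnostic census restricted to X11b with a per-(label, p) record test): the rank-ONE classes (Cremona curve 1,
non-CM) whose cell
`(p, X11b)` — `p ≥ 5`, `p ∥ N` — is OPEN on the Kurihara lane's residue of record (bsdN sweep v4u `RESIDUE.jsonl` ×
v5u verdict `residue`; on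
848 of them the lane's own tail is T-KOLY, whose single certified Heegner field excludes the primes dividing
`m·D_K`) and which are
certificate-shaped on Cremona's data — no galrep code at `p` (`ρ̄_{E,p}` onto), `p ∤ #E(ℚ)_tors·∏ c_ℓ` (so
`p ∤ c_p = ord_p Δ` at a split
`p`), `p ∤ #Ш_an` — and carry no Kolyvagin-index record `bsdp_k<label>_<p>`: 927 pairs on 869 classes (`p = 5`: 605,
`7`: 221, `11`: 41,
`13`: 20, `17 ≤ p ≤ 103`: 40; split 411 / non-split 516; 268 semistable; `1.6·10⁴ < N < 5·10⁵`). 920 of them ALSO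
carry the unit's GEN 10
beyond-window DATA record (`X11b/BeyondWindowRecordsNN`: Skinner 2016 Thm. A ∘ Stein–Wuthrich 2013 `p`-adic road,
binders as displayed there)
— for those this file is a SECOND, GRH-free and main-conjecture-free road; 7 carry no per-pair record. Not in reach
of this route (numbers, not
a verdict): the lane's 3 062 Tamagawa-obstructed X11b rank-one cells at `p ≥ 5` (`p ∣ c_q` for some `q`; Jetchev
2008's Hypothesis (∗)
`p ∤ N` fails at `p ∥ N`). THIS FILE (records 17): 10 pairs — `249690cf1@5`, `253890dh1@5`, `255255bg1@5`,
`255360bw1@5`, `256410cj1@5`, `256620a1@5`, `256620f1@5`, `261030r1@5`, `261690k1@5`, `262260e1@5`. 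

THE ROUTE (the unit's GEN 26/27 Kolyvagin route, class-agnostic): Kolyvagin's theorem as PRINTED by McCallum (LMS LN
153 (1991) §1, p. 296) /
Gross (ibid., Prop. 2.1 (2)) — tree named facts `kolyvagin`, `Kolyvagin1990_padicValNat_card_sha_le`, whose printed
hypotheses are `y_K` of
infinite order, `p` odd, `ρ̄_{E,p}` onto, and NOTHING about the reduction of `E` at `p` (at `p ∥ N` the Heegner
hypothesis — every prime of
`N` split in `K` — makes `p` split in `K`; nothing more is asked) —: `ord_p #Ш(E/K) ≤ 2·ord_p [E(K):ℤy_K]`; so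
`p ∤ [E(K):ℤy_K]` gives
`Ш(E/K)[p] = 0`, hence `Ш(E/ℚ)[p] = 0`, and with `ord_p #Ш_an = 0` Miller's `BSD(E,p)` — the tree's class-agnostic
consumer
`Typed.bsdp_of_kolyvagin_of_not_dvd_index` (`Literature/…/Rank1Residual/Typed/KolyvaginCertificate.lean`).

THE CERTIFICATE (per pair; the cell's EXISTING engines run VERBATIM — no private engine, no knob; ONE batched kit
job per stage with an
in-job fan-out wrapper): engine 1 = gen 3's `engine1_cha1b/main.py` = x9-g7 `jobD1b.py` (cypari2, sha256
`69e29ec7…`; rank-one mode: Heegner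
fields `K = ℚ(√D)`, `D < -4` fundamental, every prime of `N` split, `p ∤ D`, increasing `|D| ≤ 6000`, `≤ 30` fields;
root number of `E^D`
`+1`, rank-`≥ 2` twists skipped; `hy = L'(E,1)·L(E^D,1)·√|D|/(4·Area(E))`, `ρ = hy/ĥ(x)`, `m = √(4ρ)` an integer,
CERT iff `p ∤ m` —
Miller 2011 Thm. 4.1 / Cor. 4.8); engine 2 = gen 3's `engine2/run_cert.py` (`1b54bb20…`) + `e2lib.py` (`6701e05d…`)
+ `tate_stdlib.py`
(`ed9e5fd9…`) (stdlib python: independent `L`-series, AGM periods, Tate heights; `m`, `ord_p m` must be EQUAL;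
discrete checks — model,
conductor, Tamagawa, non-CM, irreducibility / saturation / `E(K)[p] = 0` witnesses, `D` Heegner); twist values =
additive-p1's
`twistvals/main.py` (`e501b988…`). Kit jobs: j259809, j260662, j260664, j260666, j260667. Evidence:
`HOME/b2b-bsdres-x11c/gen32/` (`KOLY-X11BR1-TABLE.md`, outputs, inputs,
SHA256SUMS); REPORT.md §41.

KERNEL (per pair, through the unit's kit theorem `X4.bsdp_prime_of_kolyvaginIndex_of_serreCounts` of
`X4/KolyvaginIndexRecordsKitOddPrime.lean` — class-agnostic despite its namespace —, every numeric hypothesis a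
`decide` goal): `Δ ≠ 0`;
global minimality of Cremona's model (bounded Kraus criterion); `ρ̄_{E,p}` ONTO by Serre's Prop. 19 from three
witness primes
`(ℓ₁, ℓ₂, ℓ₃)` (types s₁ split / s₂ non-split / s₃ `u = a²/ℓ ∉ {0,1,2,4}`, `u² − 3u + 1 ≢ 0`) whose point counts
`#Ẽ(𝔽_ℓ)` (schema
`countPoints`) are evaluated in the kernel. BINDERS (displayed in every theorem): `hGZK` (Gross–Zagier–Kolyvagin),
`hKo` / `hB` (Kolyvagin
as printed), the Heegner datum (`K`, level `N`, `P`, `p ∤ [E(K):ℤP]`), `r_an ≤ 1`, `#Ш_an = q` with `ord_p q = 0`.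
NOT rechecked in the
kernel (engine work): `L'(E,1)`, `L(E^D,1)`, periods, heights, saturation, the integrality of `4ρ`; nor the lane's
class bit (`p ∥ N`,
split / non-split — bookkeeping only, the route does not use it). What a record is worth is the owners' / lane's /
referee's call
(EVIDENCE-grade certificate under displayed binders, as every Heegner-index record of the cell).

References: McCallum 1991 §1 [McCallumLMS1991]; Gross 1991 Prop. 2.1 [GrossLMS1991]; Kolyvagin 1990
[KolyvaginEulerSystems1990]; Serre 1972 §2.8 Prop. 19 [Serre1972]; Miller 2011 Def. 1.1, Thm. 4.1, Cor. 4.8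
[Miller2011LMS];
Silverman AEC VII.1, VIII.8 [SilvermanAEC2009]; Cremona's tables [Cremona2006].
-/

set_option autoImplicit false

noncomputable section

open scoped Classical

open WeierstrassCurve Literature.NumberTheory.EllipticCurves
  Literature.NumberTheory.EllipticCurves.Rank1Residual
  Literature.NumberTheory.EllipticCurves.Rank1Residual.Typed
  Literature.NumberTheory.EllipticCurves.Rank1Residual.X11RankOneCertificates
  Summit.BirchSwinnertonDyer.BirchSwinnertonDyer.Rank1Residual.IntModel
  Summit.BirchSwinnertonDyer.BirchSwinnertonDyer.Rank1Residual.X11RankOne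
  Summit.BirchSwinnertonDyer.Rank1Residual.X4

namespace Summit.BirchSwinnertonDyer.Rank1Residual.X11b

/-- **`BSD(E,5)` for `249690cf1`** (`N = 249690 = 2·3·5·7·29·41`; SPLIT MULTIPLICATIVE at `5` (Kodaira `I1`, `c_5 = 1`, semistable); `#tors = 1`,
`∏c = 6`, `r_an = 1`, `#Ш_an = 1`, generator `(2448932, 3831125048)`; lane residue cell `(5, X11b)` (bsdN v4u/v5u of record: `residue:X11b`, lane
tail T-KOLY); ALSO the unit's GEN 10 beyond-window DATA record in `X11b/BeyondWindowRecords30.lean` (Skinner 2016 Thm. A ∘ Stein–Wuthrich 2013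
`p`-adic road, binders as displayed there) — this row is a SECOND road). `D = -2519` (2519 = 11·229): **`m = [E(K):ℤy_K] = 12`, `5 ∤ m`**
(`ρ = 36.00…`; `L'(E,1) = 14.79758674…`, `L(E^D,1) = 0.32165051…`, `ĥ(x) = 13.63222186…`) — engine 1 (j259809) = engine 2 (j260662; EQUAL, dev. ≤
2.1·10⁻¹³, checks true); twist `E^D` (j260667): `#tors·∏c·#Ш_an = 1·12·1`, prime to `5` — BSD-consistent. Witnesses mod `5` `(ℓ,#Ẽ(𝔽_ℓ))` =
`(13,18)` (`a = -4`, `a² − 4ℓ ≡ 4` square), `(11,13)` (`a = -1`, `a² − 4ℓ ≡ 2` non-square), `(17,24)` (`u ≡ 3`).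
[cite: McCallumLMS1991, §1 Theorem (Kolyvagin), p. 296] [cite: Serre1972, §2.8 Prop. 19] [cite: Cremona2006, Table 1 (label 249690cf1)] -/
theorem bsdp_k249690cf1_5 (hGZK : rank_eq_analyticRank_of_analyticRank_le_one) (W : WeierstrassCurve ℚ)
    (hW : W = ⟨1, 0, 0, -30310, -2033608⟩) {N : ℕ} [NeZero N] {K : Type} [Field K] [NumberField K]
    (hKo : kolyvagin N W K) (hB : Kolyvagin1990_padicValNat_card_sha_le N W K) (hK : IsImaginaryQuadratic K)
    (hH : SatisfiesHeegnerHypothesis N K) {P : (W.baseChange K).toAffine.Point} (hP : IsHeegnerPoint N W K P)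
    (hnt : ¬ IsOfFinAddOrder P) (hI : ¬ 5 ∣ (AddSubgroup.zmultiples P).index) (hr : W.analyticRank ≤ 1)
    {q : ℚ} (hq : shaAn W = (q : ℂ)) (hv : padicValRat 5 q = 0) : BSDp W 5 :=
  bsdp_prime_of_kolyvaginIndex_of_serreCounts 5 (by norm_num) (by norm_num) 1 0 0 (-30310) (-2033608) (by decide +kernel)
    (by decide +kernel) (by decide +kernel) 13 11 17 (by norm_num) (by norm_num) (by norm_num) (by norm_num)
    (by norm_num) (by norm_num) (by norm_num) (by norm_num) (by norm_num) (by decide +kernel) (by decide +kernel)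
    (by decide +kernel) (n₁ := 18) (n₂ := 13) (n₃ := 24) (hc₁ := by decide +kernel) (hc₂ := by decide +kernel)
    (hc₃ := by decide +kernel) (by decide +kernel) (by decide +kernel) (by decide +kernel) hGZK W
    (by rw [hW]; norm_num) hKo hB hK hH hP hnt hI hr hq hv

/-- **`BSD(E,5)` for `253890dh1`** (`N = 253890 = 2·3²·5·7·13·31`; NON-SPLIT MULTIPLICATIVE at `5` (Kodaira `I1`, `c_5 = 1`, additive at `3`);
`#tors = 6`, `∏c = 864`, `r_an = 1`, `#Ш_an = 1`, generator `(1363, 15096)`; lane residue cell `(5, X11b)` (bsdN v4u/v5u of record: `residue:X3`,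
lane tail T-BCS|open-ss, other open cells `(3, X3)`, `(7, X11b)`, `(13, X11b)`, `(31, X11b)`, `(tail, X7T)`); ALSO the unit's GEN 10 beyond-window
DATA record in `X11b/BeyondWindowRecords30.lean` (Skinner 2016 Thm. A ∘ Stein–Wuthrich 2013 `p`-adic road, binders as displayed there) — this row is
a SECOND road). `D = -5591` (5591 prime): **`m = [E(K):ℤy_K] = 576`, `5 ∤ m`** (`ρ = 82944.00…`; `L'(E,1) = 12.06252233…`,
`L(E^D,1) = 10.51690011…`, `ĥ(x) = 3.53211634…`) — engine 1 (j259809) = engine 2 (j260662; EQUAL, dev. ≤ 1.6·10⁻¹⁴, checks true); twist `E^D`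
(j260667): `#tors·∏c·#Ш_an = 2·3456·4`, prime to `5` — BSD-consistent. Witnesses mod `5` `(ℓ,#Ẽ(𝔽_ℓ))` = `(37,36)` (`a = 2`, `a² − 4ℓ ≡ 1` square),
`(41,48)` (`a = -6`, `a² − 4ℓ ≡ 2` non-square), `(73,72)` (`u ≡ 3`).
[cite: McCallumLMS1991, §1 Theorem (Kolyvagin), p. 296] [cite: Serre1972, §2.8 Prop. 19] [cite: Cremona2006, Table 1 (label 253890dh1)] -/
theorem bsdp_k253890dh1_5 (hGZK : rank_eq_analyticRank_of_analyticRank_le_one) (W : WeierstrassCurve ℚ)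
    (hW : W = ⟨1, -1, 1, -1280333, -536707339⟩) {N : ℕ} [NeZero N] {K : Type} [Field K] [NumberField K]
    (hKo : kolyvagin N W K) (hB : Kolyvagin1990_padicValNat_card_sha_le N W K) (hK : IsImaginaryQuadratic K)
    (hH : SatisfiesHeegnerHypothesis N K) {P : (W.baseChange K).toAffine.Point} (hP : IsHeegnerPoint N W K P)
    (hnt : ¬ IsOfFinAddOrder P) (hI : ¬ 5 ∣ (AddSubgroup.zmultiples P).index) (hr : W.analyticRank ≤ 1)
    {q : ℚ} (hq : shaAn W = (q : ℂ)) (hv : padicValRat 5 q = 0) : BSDp W 5 :=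
  bsdp_prime_of_kolyvaginIndex_of_serreCounts 5 (by norm_num) (by norm_num) 1 (-1) 1 (-1280333) (-536707339) (by decide +kernel)
    (by decide +kernel) (by decide +kernel) 37 41 73 (by norm_num) (by norm_num) (by norm_num) (by norm_num)
    (by norm_num) (by norm_num) (by norm_num) (by norm_num) (by norm_num) (by decide +kernel) (by decide +kernel)
    (by decide +kernel) (n₁ := 36) (n₂ := 48) (n₃ := 72) (hc₁ := by decide +kernel) (hc₂ := by decide +kernel)
    (hc₃ := by decide +kernel) (by decide +kernel) (by decide +kernel) (by decide +kernel) hGZK W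
    (by rw [hW]; norm_num) hKo hB hK hH hP hnt hI hr hq hv

/-- **`BSD(E,5)` for `255255bg1`** (`N = 255255 = 3·5·7·11·13·17`; SPLIT MULTIPLICATIVE at `5` (Kodaira `I1`, `c_5 = 1`, semistable); `#tors = 2`,
`∏c = 2`, `r_an = 1`, `#Ш_an = 4`, generator `(3447337/256, 6372934979/4096)`; lane residue cell `(5, X11b)` (bsdN v4u/v5u of record:
`residue:X11b`, lane tail T-KOLY); ALSO the unit's GEN 10 beyond-window DATA record in `X11b/BeyondWindowRecords31.lean` (Skinner 2016 Thm. A ∘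
Stein–Wuthrich 2013 `p`-adic road, binders as displayed there) — this row is a SECOND road). `D = -1811` (1811 prime): **`m = [E(K):ℤy_K] = 48`,
`5 ∤ m`** (`ρ = 576.00…`; `L'(E,1) = 10.88358432…`, `L(E^D,1) = 2.52406386…`, `ĥ(x) = 15.05955039…`) — engine 1 (j259809) = engine 2 (j260664;
EQUAL, dev. ≤ 1.9·10⁻¹⁴, checks true); twist `E^D` (j260667): `#tors·∏c·#Ш_an = 2·4·576`, prime to `5` — BSD-consistent. Witnesses mod `5`
`(ℓ,#Ẽ(𝔽_ℓ))` = `(37,36)` (`a = 2`, `a² − 4ℓ ≡ 1` square), `(23,32)` (`a = -8`, `a² − 4ℓ ≡ 2` non-square), `(23,32)` (`u ≡ 3`).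
[cite: McCallumLMS1991, §1 Theorem (Kolyvagin), p. 296] [cite: Serre1972, §2.8 Prop. 19] [cite: Cremona2006, Table 1 (label 255255bg1)] -/
theorem bsdp_k255255bg1_5 (hGZK : rank_eq_analyticRank_of_analyticRank_le_one) (W : WeierstrassCurve ℚ)
    (hW : W = ⟨1, 0, 1, -12513, 3487591⟩) {N : ℕ} [NeZero N] {K : Type} [Field K] [NumberField K]
    (hKo : kolyvagin N W K) (hB : Kolyvagin1990_padicValNat_card_sha_le N W K) (hK : IsImaginaryQuadratic K)
    (hH : SatisfiesHeegnerHypothesis N K) {P : (W.baseChange K).toAffine.Point} (hP : IsHeegnerPoint N W K P)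
    (hnt : ¬ IsOfFinAddOrder P) (hI : ¬ 5 ∣ (AddSubgroup.zmultiples P).index) (hr : W.analyticRank ≤ 1)
    {q : ℚ} (hq : shaAn W = (q : ℂ)) (hv : padicValRat 5 q = 0) : BSDp W 5 :=
  bsdp_prime_of_kolyvaginIndex_of_serreCounts 5 (by norm_num) (by norm_num) 1 0 1 (-12513) 3487591 (by decide +kernel)
    (by decide +kernel) (by decide +kernel) 37 23 23 (by norm_num) (by norm_num) (by norm_num) (by norm_num)
    (by norm_num) (by norm_num) (by norm_num) (by norm_num) (by norm_num) (by decide +kernel) (by decide +kernel)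
    (by decide +kernel) (n₁ := 36) (n₂ := 32) (n₃ := 32) (hc₁ := by decide +kernel) (hc₂ := by decide +kernel)
    (hc₃ := by decide +kernel) (by decide +kernel) (by decide +kernel) (by decide +kernel) hGZK W
    (by rw [hW]; norm_num) hKo hB hK hH hP hnt hI hr hq hv

/-- **`BSD(E,5)` for `255360bw1`** (`N = 255360 = 2⁷·3·5·7·19`; SPLIT MULTIPLICATIVE at `5` (Kodaira `I1`, `c_5 = 1`, additive at `2`); `#tors = 2`,
`∏c = 8`, `r_an = 1`, `#Ш_an = 1`, generator Cremona's (45-digit numerator); lane residue cell `(5, X11b)` (bsdN v4u/v5u of record: `residue:X11b`,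
lane tail T-KOLY); ALSO the unit's GEN 10 beyond-window DATA record in `X11b/BeyondWindowRecords31.lean` (Skinner 2016 Thm. A ∘ Stein–Wuthrich 2013
`p`-adic road, binders as displayed there) — this row is a SECOND road). `D = -1511` (1511 prime): **`m = [E(K):ℤy_K] = 16`, `5 ∤ m`**
(`ρ = 64.00…`; `L'(E,1) = 6.09613012…`, `L(E^D,1) = 0.11437084…`, `ĥ(x) = 101.54470377…`) — engine 1 (j259809) = engine 2 (j260664; EQUAL, dev. ≤
7.6·10⁻¹⁴, checks true); twist `E^D` (j260667): `#tors·∏c·#Ш_an = 2·16·16`, prime to `5` — BSD-consistent. Witnesses mod `5` `(ℓ,#Ẽ(𝔽_ℓ))` =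
`(23,20)` (`a = 4`, `a² − 4ℓ ≡ 4` square), `(13,12)` (`a = 2`, `a² − 4ℓ ≡ 2` non-square), `(13,12)` (`u ≡ 3`).
[cite: McCallumLMS1991, §1 Theorem (Kolyvagin), p. 296] [cite: Serre1972, §2.8 Prop. 19] [cite: Cremona2006, Table 1 (label 255360bw1)] -/
theorem bsdp_k255360bw1_5 (hGZK : rank_eq_analyticRank_of_analyticRank_le_one) (W : WeierstrassCurve ℚ)
    (hW : W = ⟨0, -1, 0, -33357070, -130712224310⟩) {N : ℕ} [NeZero N] {K : Type} [Field K] [NumberField K]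
    (hKo : kolyvagin N W K) (hB : Kolyvagin1990_padicValNat_card_sha_le N W K) (hK : IsImaginaryQuadratic K)
    (hH : SatisfiesHeegnerHypothesis N K) {P : (W.baseChange K).toAffine.Point} (hP : IsHeegnerPoint N W K P)
    (hnt : ¬ IsOfFinAddOrder P) (hI : ¬ 5 ∣ (AddSubgroup.zmultiples P).index) (hr : W.analyticRank ≤ 1)
    {q : ℚ} (hq : shaAn W = (q : ℂ)) (hv : padicValRat 5 q = 0) : BSDp W 5 :=
  bsdp_prime_of_kolyvaginIndex_of_serreCounts 5 (by norm_num) (by norm_num) 0 (-1) 0 (-33357070) (-130712224310) (by decide +kernel)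
    (by decide +kernel) (by decide +kernel) 23 13 13 (by norm_num) (by norm_num) (by norm_num) (by norm_num)
    (by norm_num) (by norm_num) (by norm_num) (by norm_num) (by norm_num) (by decide +kernel) (by decide +kernel)
    (by decide +kernel) (n₁ := 20) (n₂ := 12) (n₃ := 12) (hc₁ := by decide +kernel) (hc₂ := by decide +kernel)
    (hc₃ := by decide +kernel) (by decide +kernel) (by decide +kernel) (by decide +kernel) hGZK W
    (by rw [hW]; norm_num) hKo hB hK hH hP hnt hI hr hq hv

/-- **`BSD(E,5)` for `256410cj1`** (`N = 256410 = 2·3²·5·7·11·37`; SPLIT MULTIPLICATIVE at `5` (Kodaira `I1`, `c_5 = 1`, additive at `3`); `#tors = 1`,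
`∏c = 16`, `r_an = 1`, `#Ш_an = 1`, generator `(-11, 348)`; lane residue cell `(5, X11b)` (bsdN v4u/v5u of record: `residue:X11b`, lane tail
T-KOLY); ALSO the unit's GEN 10 beyond-window DATA record in `X11b/BeyondWindowRecords31.lean` (Skinner 2016 Thm. A ∘ Stein–Wuthrich 2013 `p`-adic
road, binders as displayed there) — this row is a SECOND road). `D = -3911` (3911 prime): **`m = [E(K):ℤy_K] = 32`, `5 ∤ m`** (`ρ = 256.00…`;
`L'(E,1) = 12.27184109…`, `L(E^D,1) = 0.15897182…`, `ĥ(x) = 0.72343320…`) — engine 1 (j259809) = engine 2 (j260664; EQUAL, dev. ≤ 1.5·10⁻¹³, checks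
true); twist `E^D` (j260667): `#tors·∏c·#Ш_an = 1·32·1`, prime to `5` — BSD-consistent. Witnesses mod `5` `(ℓ,#Ẽ(𝔽_ℓ))` = `(17,25)` (`a = -7`,
`a² − 4ℓ ≡ 1` square), `(29,32)` (`a = -2`, `a² − 4ℓ ≡ 3` non-square), `(73,67)` (`u ≡ 3`).
[cite: McCallumLMS1991, §1 Theorem (Kolyvagin), p. 296] [cite: Serre1972, §2.8 Prop. 19] [cite: Cremona2006, Table 1 (label 256410cj1)] -/
theorem bsdp_k256410cj1_5 (hGZK : rank_eq_analyticRank_of_analyticRank_le_one) (W : WeierstrassCurve ℚ)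
    (hW : W = ⟨1, -1, 1, -3467, 80939⟩) {N : ℕ} [NeZero N] {K : Type} [Field K] [NumberField K]
    (hKo : kolyvagin N W K) (hB : Kolyvagin1990_padicValNat_card_sha_le N W K) (hK : IsImaginaryQuadratic K)
    (hH : SatisfiesHeegnerHypothesis N K) {P : (W.baseChange K).toAffine.Point} (hP : IsHeegnerPoint N W K P)
    (hnt : ¬ IsOfFinAddOrder P) (hI : ¬ 5 ∣ (AddSubgroup.zmultiples P).index) (hr : W.analyticRank ≤ 1)
    {q : ℚ} (hq : shaAn W = (q : ℂ)) (hv : padicValRat 5 q = 0) : BSDp W 5 :=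
  bsdp_prime_of_kolyvaginIndex_of_serreCounts 5 (by norm_num) (by norm_num) 1 (-1) 1 (-3467) 80939 (by decide +kernel)
    (by decide +kernel) (by decide +kernel) 17 29 73 (by norm_num) (by norm_num) (by norm_num) (by norm_num)
    (by norm_num) (by norm_num) (by norm_num) (by norm_num) (by norm_num) (by decide +kernel) (by decide +kernel)
    (by decide +kernel) (n₁ := 25) (n₂ := 32) (n₃ := 67) (hc₁ := by decide +kernel) (hc₂ := by decide +kernel)
    (hc₃ := by decide +kernel) (by decide +kernel) (by decide +kernel) (by decide +kernel) hGZK W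
    (by rw [hW]; norm_num) hKo hB hK hH hP hnt hI hr hq hv

/-- **`BSD(E,5)` for `256620a1`** (`N = 256620 = 2²·3·5·7·13·47`; NON-SPLIT MULTIPLICATIVE at `5` (Kodaira `I8`, `c_5 = 2`, additive at `2`);
`#tors = 1`, `∏c = 4`, `r_an = 1`, `#Ш_an = 1`, generator `(3784/9, 105625/27)`; lane residue cell `(5, X11b)` (bsdN v4u/v5u of record:
`residue:X11b,X7`, lane tail T-KOLY, other open cells `(311, X7)`); ALSO the unit's GEN 10 beyond-window DATA record in
`X11b/BeyondWindowRecords31.lean` (Skinner 2016 Thm. A ∘ Stein–Wuthrich 2013 `p`-adic road, binders as displayed there) — this row is a SECOND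
road). `D = -2159` (2159 = 17·127): **`m = [E(K):ℤy_K] = 8`, `5 ∤ m`** (`ρ = 15.99…`; `L'(E,1) = 4.07384703…`, `L(E^D,1) = 0.01417154…`,
`ĥ(x) = 3.92565317…`) — engine 1 (j259809) = engine 2 (j260664; EQUAL, dev. ≤ 9.6·10⁻¹³, checks true); twist `E^D` (j260667):
`#tors·∏c·#Ш_an = 1·8·1`, prime to `5` — BSD-consistent. Witnesses mod `5` `(ℓ,#Ẽ(𝔽_ℓ))` = `(17,21)` (`a = -3`, `a² − 4ℓ ≡ 1` square), `(23,31)`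
(`a = -7`, `a² − 4ℓ ≡ 2` non-square), `(23,31)` (`u ≡ 3`).
[cite: McCallumLMS1991, §1 Theorem (Kolyvagin), p. 296] [cite: Serre1972, §2.8 Prop. 19] [cite: Cremona2006, Table 1 (label 256620a1)] -/
theorem bsdp_k256620a1_5 (hGZK : rank_eq_analyticRank_of_analyticRank_le_one) (W : WeierstrassCurve ℚ)
    (hW : W = ⟨0, -1, 0, -698901, 235006401⟩) {N : ℕ} [NeZero N] {K : Type} [Field K] [NumberField K]
    (hKo : kolyvagin N W K) (hB : Kolyvagin1990_padicValNat_card_sha_le N W K) (hK : IsImaginaryQuadratic K)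
    (hH : SatisfiesHeegnerHypothesis N K) {P : (W.baseChange K).toAffine.Point} (hP : IsHeegnerPoint N W K P)
    (hnt : ¬ IsOfFinAddOrder P) (hI : ¬ 5 ∣ (AddSubgroup.zmultiples P).index) (hr : W.analyticRank ≤ 1)
    {q : ℚ} (hq : shaAn W = (q : ℂ)) (hv : padicValRat 5 q = 0) : BSDp W 5 :=
  bsdp_prime_of_kolyvaginIndex_of_serreCounts 5 (by norm_num) (by norm_num) 0 (-1) 0 (-698901) 235006401 (by decide +kernel)
    (by decide +kernel) (by decide +kernel) 17 23 23 (by norm_num) (by norm_num) (by norm_num) (by norm_num)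
    (by norm_num) (by norm_num) (by norm_num) (by norm_num) (by norm_num) (by decide +kernel) (by decide +kernel)
    (by decide +kernel) (n₁ := 21) (n₂ := 31) (n₃ := 31) (hc₁ := by decide +kernel) (hc₂ := by decide +kernel)
    (hc₃ := by decide +kernel) (by decide +kernel) (by decide +kernel) (by decide +kernel) hGZK W
    (by rw [hW]; norm_num) hKo hB hK hH hP hnt hI hr hq hv

/-- **`BSD(E,5)` for `256620f1`** (`N = 256620 = 2²·3·5·7·13·47`; NON-SPLIT MULTIPLICATIVE at `5` (Kodaira `I2`, `c_5 = 2`, additive at `2`);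
`#tors = 1`, `∏c = 12`, `r_an = 1`, `#Ш_an = 1`, generator `(511, 11830)`; lane residue cell `(5, X11b)` (bsdN v4u/v5u of record: `residue:X11b`,
lane tail T-KOLY); ALSO the unit's GEN 10 beyond-window DATA record in `X11b/BeyondWindowRecords31.lean` (Skinner 2016 Thm. A ∘ Stein–Wuthrich 2013
`p`-adic road, binders as displayed there) — this row is a SECOND road). `D = -2159` (2159 = 17·127): **`m = [E(K):ℤy_K] = 24`, `5 ∤ m`**
(`ρ = 144.00…`; `L'(E,1) = 4.16670046…`, `L(E^D,1) = 0.11703754…`, `ĥ(x) = 2.28937675…`) — engine 1 (j259809) = engine 2 (j260664; EQUAL, dev. ≤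
3.8·10⁻¹⁵, checks true); twist `E^D` (j260667): `#tors·∏c·#Ш_an = 1·24·1`, prime to `5` — BSD-consistent. Witnesses mod `5` `(ℓ,#Ẽ(𝔽_ℓ))` =
`(37,41)` (`a = -3`, `a² − 4ℓ ≡ 1` square), `(17,19)` (`a = -1`, `a² − 4ℓ ≡ 3` non-square), `(17,19)` (`u ≡ 3`).
[cite: McCallumLMS1991, §1 Theorem (Kolyvagin), p. 296] [cite: Serre1972, §2.8 Prop. 19] [cite: Cremona2006, Table 1 (label 256620f1)] -/
theorem bsdp_k256620f1_5 (hGZK : rank_eq_analyticRank_of_analyticRank_le_one) (W : WeierstrassCurve ℚ)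
    (hW : W = ⟨0, -1, 0, 62659, -25241559⟩) {N : ℕ} [NeZero N] {K : Type} [Field K] [NumberField K]
    (hKo : kolyvagin N W K) (hB : Kolyvagin1990_padicValNat_card_sha_le N W K) (hK : IsImaginaryQuadratic K)
    (hH : SatisfiesHeegnerHypothesis N K) {P : (W.baseChange K).toAffine.Point} (hP : IsHeegnerPoint N W K P)
    (hnt : ¬ IsOfFinAddOrder P) (hI : ¬ 5 ∣ (AddSubgroup.zmultiples P).index) (hr : W.analyticRank ≤ 1)
    {q : ℚ} (hq : shaAn W = (q : ℂ)) (hv : padicValRat 5 q = 0) : BSDp W 5 :=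
  bsdp_prime_of_kolyvaginIndex_of_serreCounts 5 (by norm_num) (by norm_num) 0 (-1) 0 62659 (-25241559) (by decide +kernel)
    (by decide +kernel) (by decide +kernel) 37 17 17 (by norm_num) (by norm_num) (by norm_num) (by norm_num)
    (by norm_num) (by norm_num) (by norm_num) (by norm_num) (by norm_num) (by decide +kernel) (by decide +kernel)
    (by decide +kernel) (n₁ := 41) (n₂ := 19) (n₃ := 19) (hc₁ := by decide +kernel) (hc₂ := by decide +kernel)
    (hc₃ := by decide +kernel) (by decide +kernel) (by decide +kernel) (by decide +kernel) hGZK W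
    (by rw [hW]; norm_num) hKo hB hK hH hP hnt hI hr hq hv

/-- **`BSD(E,5)` for `261030r1`** (`N = 261030 = 2·3·5·7·11·113`; NON-SPLIT MULTIPLICATIVE at `5` (Kodaira `I3`, `c_5 = 1`, semistable); `#tors = 1`,
`∏c = 2`, `r_an = 1`, `#Ш_an = 1`, generator `(190, 2528)`; lane residue cell `(5, X11b)` (bsdN v4u/v5u of record: `residue:X11b`, lane tail
T-KOLY); ALSO the unit's GEN 10 beyond-window DATA record in `X11b/BeyondWindowRecords31.lean` (Skinner 2016 Thm. A ∘ Stein–Wuthrich 2013 `p`-adic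
road, binders as displayed there) — this row is a SECOND road). `D = -2351` (2351 prime): **`m = [E(K):ℤy_K] = 4`, `5 ∤ m`** (`ρ = 3.99…`;
`L'(E,1) = 7.11899376…`, `L(E^D,1) = 0.10264158…`, `ĥ(x) = 4.07755962…`) — engine 1 (j259809) = engine 2 (j260666; EQUAL, dev. ≤ 1.9·10⁻¹³, checks
true); twist `E^D` (j260667): `#tors·∏c·#Ш_an = 1·4·1`, prime to `5` — BSD-consistent. Witnesses mod `5` `(ℓ,#Ẽ(𝔽_ℓ))` = `(67,61)` (`a = 7`,
`a² − 4ℓ ≡ 1` square), `(13,16)` (`a = -2`, `a² − 4ℓ ≡ 2` non-square), `(13,16)` (`u ≡ 3`).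
[cite: McCallumLMS1991, §1 Theorem (Kolyvagin), p. 296] [cite: Serre1972, §2.8 Prop. 19] [cite: Cremona2006, Table 1 (label 261030r1)] -/
theorem bsdp_k261030r1_5 (hGZK : rank_eq_analyticRank_of_analyticRank_le_one) (W : WeierstrassCurve ℚ)
    (hW : W = ⟨1, 0, 1, 81, -758⟩) {N : ℕ} [NeZero N] {K : Type} [Field K] [NumberField K]
    (hKo : kolyvagin N W K) (hB : Kolyvagin1990_padicValNat_card_sha_le N W K) (hK : IsImaginaryQuadratic K)
    (hH : SatisfiesHeegnerHypothesis N K) {P : (W.baseChange K).toAffine.Point} (hP : IsHeegnerPoint N W K P)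
    (hnt : ¬ IsOfFinAddOrder P) (hI : ¬ 5 ∣ (AddSubgroup.zmultiples P).index) (hr : W.analyticRank ≤ 1)
    {q : ℚ} (hq : shaAn W = (q : ℂ)) (hv : padicValRat 5 q = 0) : BSDp W 5 :=
  bsdp_prime_of_kolyvaginIndex_of_serreCounts 5 (by norm_num) (by norm_num) 1 0 1 81 (-758) (by decide +kernel)
    (by decide +kernel) (by decide +kernel) 67 13 13 (by norm_num) (by norm_num) (by norm_num) (by norm_num)
    (by norm_num) (by norm_num) (by norm_num) (by norm_num) (by norm_num) (by decide +kernel) (by decide +kernel)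
    (by decide +kernel) (n₁ := 61) (n₂ := 16) (n₃ := 16) (hc₁ := by decide +kernel) (hc₂ := by decide +kernel)
    (hc₃ := by decide +kernel) (by decide +kernel) (by decide +kernel) (by decide +kernel) hGZK W
    (by rw [hW]; norm_num) hKo hB hK hH hP hnt hI hr hq hv

/-- **`BSD(E,5)` for `261690k1`** (`N = 261690 = 2·3·5·11·13·61`; SPLIT MULTIPLICATIVE at `5` (Kodaira `I2`, `c_5 = 2`, semistable); `#tors = 2`,
`∏c = 16`, `r_an = 1`, `#Ш_an = 1`, generator Cremona's (10-digit numerator); lane residue cell `(5, X11b)` (bsdN v4u/v5u of record: `residue:X11b`,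
lane tail T-KOLY); ALSO the unit's GEN 10 beyond-window DATA record in `X11b/BeyondWindowRecords31.lean` (Skinner 2016 Thm. A ∘ Stein–Wuthrich 2013
`p`-adic road, binders as displayed there) — this row is a SECOND road). `D = -2279` (2279 = 43·53): **`m = [E(K):ℤy_K] = 32`, `5 ∤ m`**
(`ρ = 256.00…`; `L'(E,1) = 5.65018773…`, `L(E^D,1) = 0.36319574…`, `ĥ(x) = 17.51655363…`) — engine 1 (j259809) = engine 2 (j260666; EQUAL, dev. ≤
1.3·10⁻¹³, checks true); twist `E^D` (j260667): `#tors·∏c·#Ш_an = 2·128·4`, prime to `5` — BSD-consistent. Witnesses mod `5` `(ℓ,#Ẽ(𝔽_ℓ))` =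
`(23,20)` (`a = 4`, `a² − 4ℓ ≡ 4` square), `(17,12)` (`a = 6`, `a² − 4ℓ ≡ 3` non-square), `(17,12)` (`u ≡ 3`).
[cite: McCallumLMS1991, §1 Theorem (Kolyvagin), p. 296] [cite: Serre1972, §2.8 Prop. 19] [cite: Cremona2006, Table 1 (label 261690k1)] -/
theorem bsdp_k261690k1_5 (hGZK : rank_eq_analyticRank_of_analyticRank_le_one) (W : WeierstrassCurve ℚ)
    (hW : W = ⟨1, 1, 0, 130708, -817281456⟩) {N : ℕ} [NeZero N] {K : Type} [Field K] [NumberField K]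
    (hKo : kolyvagin N W K) (hB : Kolyvagin1990_padicValNat_card_sha_le N W K) (hK : IsImaginaryQuadratic K)
    (hH : SatisfiesHeegnerHypothesis N K) {P : (W.baseChange K).toAffine.Point} (hP : IsHeegnerPoint N W K P)
    (hnt : ¬ IsOfFinAddOrder P) (hI : ¬ 5 ∣ (AddSubgroup.zmultiples P).index) (hr : W.analyticRank ≤ 1)
    {q : ℚ} (hq : shaAn W = (q : ℂ)) (hv : padicValRat 5 q = 0) : BSDp W 5 :=
  bsdp_prime_of_kolyvaginIndex_of_serreCounts 5 (by norm_num) (by norm_num) 1 1 0 130708 (-817281456) (by decide +kernel)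
    (by decide +kernel) (by decide +kernel) 23 17 17 (by norm_num) (by norm_num) (by norm_num) (by norm_num)
    (by norm_num) (by norm_num) (by norm_num) (by norm_num) (by norm_num) (by decide +kernel) (by decide +kernel)
    (by decide +kernel) (n₁ := 20) (n₂ := 12) (n₃ := 12) (hc₁ := by decide +kernel) (hc₂ := by decide +kernel)
    (hc₃ := by decide +kernel) (by decide +kernel) (by decide +kernel) (by decide +kernel) hGZK W
    (by rw [hW]; norm_num) hKo hB hK hH hP hnt hI hr hq hv

/-- **`BSD(E,5)` for `262260e1`** (`N = 262260 = 2²·3²·5·31·47`; SPLIT MULTIPLICATIVE at `5` (Kodaira `I3`, `c_5 = 3`, additive at `2`, `3`);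
`#tors = 1`, `∏c = 12`, `r_an = 1`, `#Ш_an = 1`, generator `(33/4, 4185/8)`; lane residue cell `(5, X11b)` (bsdN v4u/v5u of record: `residue:X11b`,
lane tail T-KOLY); ALSO the unit's GEN 10 beyond-window DATA record in `X11b/BeyondWindowRecords32.lean` (Skinner 2016 Thm. A ∘ Stein–Wuthrich 2013
`p`-adic road, binders as displayed there) — this row is a SECOND road). `D = -3239` (3239 = 41·79): **`m = [E(K):ℤy_K] = 96`, `5 ∤ m`**
(`ρ = 2303.99…`; `L'(E,1) = 9.29637007…`, `L(E^D,1) = 2.19681986…`, `ĥ(x) = 1.57484179…`) — engine 1 (j259809) = engine 2 (j260666; EQUAL, dev. ≤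
6.4·10⁻¹⁴, checks true); twist `E^D` (j260667): `#tors·∏c·#Ш_an = 1·24·16`, prime to `5` — BSD-consistent. Witnesses mod `5` `(ℓ,#Ẽ(𝔽_ℓ))` =
`(13,13)` (`a = 1`, `a² − 4ℓ ≡ 4` square), `(7,7)` (`a = 1`, `a² − 4ℓ ≡ 3` non-square), `(7,7)` (`u ≡ 3`).
[cite: McCallumLMS1991, §1 Theorem (Kolyvagin), p. 296] [cite: Serre1972, §2.8 Prop. 19] [cite: Cremona2006, Table 1 (label 262260e1)] -/
theorem bsdp_k262260e1_5 (hGZK : rank_eq_analyticRank_of_analyticRank_le_one) (W : WeierstrassCurve ℚ)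
    (hW : W = ⟨0, 0, 0, 2673, 251046⟩) {N : ℕ} [NeZero N] {K : Type} [Field K] [NumberField K]
    (hKo : kolyvagin N W K) (hB : Kolyvagin1990_padicValNat_card_sha_le N W K) (hK : IsImaginaryQuadratic K)
    (hH : SatisfiesHeegnerHypothesis N K) {P : (W.baseChange K).toAffine.Point} (hP : IsHeegnerPoint N W K P)
    (hnt : ¬ IsOfFinAddOrder P) (hI : ¬ 5 ∣ (AddSubgroup.zmultiples P).index) (hr : W.analyticRank ≤ 1)
    {q : ℚ} (hq : shaAn W = (q : ℂ)) (hv : padicValRat 5 q = 0) : BSDp W 5 :=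
  bsdp_prime_of_kolyvaginIndex_of_serreCounts 5 (by norm_num) (by norm_num) 0 0 0 2673 251046 (by decide +kernel)
    (by decide +kernel) (by decide +kernel) 13 7 7 (by norm_num) (by norm_num) (by norm_num) (by norm_num)
    (by norm_num) (by norm_num) (by norm_num) (by norm_num) (by norm_num) (by decide +kernel) (by decide +kernel)
    (by decide +kernel) (n₁ := 13) (n₂ := 7) (n₃ := 7) (hc₁ := by decide +kernel) (hc₂ := by decide +kernel)
    (hc₃ := by decide +kernel) (by decide +kernel) (by decide +kernel) (by decide +kernel) hGZK W
    (by rw [hW]; norm_num) hKo hB hK hH hP hnt hI hr hq hv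

end Summit.BirchSwinnertonDyer.Rank1Residual.X11b

end
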